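import Summits.BirchSwinnertonDyer.BirchSwinnertonDyer.Theorems.RamifiedSevenEllipticUnitsBottomSaturationRank
import Summits.BirchSwinnertonDyer.BirchSwinnertonDyer.Theorems.RamifiedSevenEllipticUnitsRelaxedEqCompactRank
import HarnessLib

set_option linter.dupNamespace false
set_option autoImplicit false

/-!
# Route `RamifiedSevenEllipticUnits` (rung K7r), value crux `EllipticUnitValueSevenOfGZK`
# (stmt-BirchSwinnertonDyer-19945), line `rubin-formula-zp`: **the registered stub S_sat-Zp
# `stub_bottomSaturationSevenZpOfGZK` PROVED UNCONDITIONALLY** — (sat) `S_{p,rel}(E/K) ≤ E(K) ⊗ ℤ_p` at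
# every O11 frame from the bottom index exponent alone, with the «two generators of `End_K(E)`» input
# DISCHARGED by the tree (no named fact F2, no GZK, no `Ш`, no reciprocity law, no duality)

Cell `bsd-cm`, seat `bsd-cm-k7r-c2` g5. HONEST FRAMING: this closes ONE registered stub of the crux line
(stub credit `--supports 19945`); the crux `EllipticUnitValueSevenOfGZK` stays OPEN on its research stub
S_open `stub_rubinFormulaSevenZp` (the ramified Rubin/BDP value formula, not in print) and the route on
its residual `EllipticUnitIMCSevenZp`; BSD is not claimed; no named fact is minted; no definition is
introduced; `sorry`-free.

## How it differs from `…BottomSaturationRank` (k7r-c4 g6, p478864)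

That file proves S_sat-Zp MODULO the statement-only named fact F2 `endRing_twoGenerated` («`End_K(E)`
is `ℤ`-spanned by two elements», Silverman Cor. III.9.4). Here the same rank route runs on the WEAKER
input that the tree PROVES: `EndRankTwo.exists_generator_endRing` (p477375; from
`exists_int_quadratic_of_mem_geomEndRing` + `exists_intCast_mul_eq_of_mem_geomEndRing`) — every
`c ∈ End_K(E)` is COMMENSURABLE with `ℤ + ℤψ` (`N c = a + b ψ`, `N ≠ 0`), which is all Cramer's rule needs:
(G1) `exists_zsmul_mem_of_rank` — under `[S_rel : tors ⊔ 𝒪_𝔭 · z] = p^c`, every `x ∈ S_rel` has a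
non-zero multiple in any `ℤ_p`-stable subgroup `M` containing two `ℤ_p`-independent families
(`RelaxedEqCompactRank`, p478017); with `M := E(K) ⊗ ℤ_p ∋ κ(P_K), κ(T₂)` (the frame chart, k7r-c3) and
the SATURATION of `E(K) ⊗ ℤ_p` among compatible families (`BottomSaturationRank.mem_mordellWeilKummerSpan_of_zsmul_mem`,
k7r-c4 p478864 over k8i-c2's compact Kummer descent p474926; Mordell–Weil `moduleFinite_fixedGeomPoints_top`) and
`S_rel = S_p` (`RelaxedEqCompactRank.relaxed_eq_compact_of_frame`): `S_rel ≤ E(K) ⊗ ℤ_p`.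

## Results

* `BottomSaturationUncond.exists_zsmul_mem_of_rank` (G1), `kummerFamily_mem_mordellWeilKummerSpan`,
  `relaxed_le_mordellWeilKummerSpan_of_frame_rank`, `ramifiedCMBottomSaturationAtZp_holds (W) (p)` —
  `X12.O11.RamifiedCMBottomSaturationAtZp W p` at EVERY frame and EVERY prime, unconditionally;
* `stub_bottomSaturationSevenZpOfGZK` — the registered stub of stmt-BirchSwinnertonDyer-19945, by name.

References: B. Perrin-Riou, Bull. SMF 115 (1987) §0 pp. 401–402 [PerrinRiou1987BSMF]; J. H. Silverman,
*AEC* (2009) Thm. VIII.6.7, Cor. III.9.4, Ex. 10.16 [SilvermanAEC2009]; [BKNO] arXiv:2608.06879v1 §3.1.2,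
§3.3.1, Prop. 3.7 [BurungaleKobayashiNakamuraOta2026]; cell texts `Lines/rubin-formula-zp.md`,
MEMO-k7r-c4-g6-CONTINUATION §4, STATUS D117/D121.
-/

noncomputable section

open scoped Classical

open WeierstrassCurve NumberField IsDedekindDomain Field
  Literature.NumberTheory.EllipticCurves
  Literature.NumberTheory.GaloisRepresentations
  Literature.NumberTheory.EllipticCurves.BurungaleKobayashiNakamuraOta2026
  Summit.BirchSwinnertonDyer.Rank1Residual

universe u

namespace Summit.BirchSwinnertonDyer.BirchSwinnertonDyer.Theorems.RamifiedSevenEllipticUnits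

namespace BottomSaturationUncond

/-! ## (G1) The Cramer step inside a `ℤ_p`-stable subgroup -/

section Cramer

variable {K : Type u} [Field K] [NumberField K] (V : WeierstrassCurve K) [V.IsElliptic] (p : ℕ)
  [Fact p.Prime] (κ : ZpExtension K p)

/-- **(G1) Every `x ∈ S_{p,rel}` has a non-zero multiple in any `ℤ_p`-stable subgroup `M` containing two
`ℤ_p`-independent families**, given `[S_rel : tors ⊔ 𝒪_𝔭 · z] = p^c`: with `Nᵢ κᵢ = αᵢ z + βᵢ ψz`
(`RelaxedEqCompactRank.exists_zsmul_eq_pair_of_mem_relaxed`) and `δ = α₁β₂ − α₂β₁`, Cramer gives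
`δ · z, δ · ψz ∈ M`, independence gives `δ ≠ 0`, `δ = u p^a`, and `(p^a N) • x ∈ M`. (The case `M = S_p` is
`relaxed_eq_compact_of_rank`.) [cite: BurungaleKobayashiNakamuraOta2026, §3.3.1 and Prop. 3.7 (3) (arXiv:2608.06879 pp. 19–20) (shape only)]
[cite: SilvermanAEC2009, Cor. III.9.4] -/
theorem exists_zsmul_mem_of_rank (P : Set (HeightOneSpectrum (𝓞 K)))
    (M : AddSubgroup (V.torsionH1Pi p (κ.layerSubgroup 0)))
    (hM : ∀ (c : ℤ_[p]) {y}, y ∈ M → V.padicPi p (κ.layerSubgroup 0) c y ∈ M)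
    {z : V.torsionH1Pi p (κ.layerSubgroup 0)} {c : ℕ}
    (hc : (AddCommGroup.torsion (V.torsionH1Pi p (κ.layerSubgroup 0)) ⊔
        V.padicEndSpan p (κ.layerSubgroup 0) z).relIndex
      (V.relaxedCompactSelmerOver (κ.layerSubgroup 0) p P) = p ^ c)
    {κ₁ κ₂ : V.torsionH1Pi p (κ.layerSubgroup 0)} (h₁ : κ₁ ∈ M) (h₂ : κ₂ ∈ M)
    (h₁' : κ₁ ∈ V.relaxedCompactSelmerOver (κ.layerSubgroup 0) p P)
    (h₂' : κ₂ ∈ V.relaxedCompactSelmerOver (κ.layerSubgroup 0) p P)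
    (hind : ∀ α β : ℤ_[p],
      V.padicPi p (κ.layerSubgroup 0) α κ₁ + V.padicPi p (κ.layerSubgroup 0) β κ₂ = 0 → α = 0 ∧ β = 0)
    {x : V.torsionH1Pi p (κ.layerSubgroup 0)}
    (hx : x ∈ V.relaxedCompactSelmerOver (κ.layerSubgroup 0) p P) :
    ∃ N : ℤ, N ≠ 0 ∧ N • x ∈ M := by
  have hp : p.Prime := Fact.out
  haveI : CharZero K := inferInstance
  obtain ⟨ψ, hψ, hall⟩ := EndRankTwo.exists_generator_endRing V
  obtain ⟨N₁, hN₁, α₁, β₁, e₁⟩ :=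
    RelaxedEqCompactRank.exists_zsmul_eq_pair_of_mem_relaxed V p κ P hψ hall hc h₁'
  obtain ⟨N₂, hN₂, α₂, β₂, e₂⟩ :=
    RelaxedEqCompactRank.exists_zsmul_eq_pair_of_mem_relaxed V p κ P hψ hall hc h₂'
  have hMz : ∀ (N : ℤ) {y}, y ∈ M → N • y ∈ M := fun N _ hy ↦ zsmul_mem hy N
  -- Cramer
  have hδz : V.padicPi p (κ.layerSubgroup 0) (α₁ * β₂ - α₂ * β₁) z =
      V.padicPi p (κ.layerSubgroup 0) β₂ (N₁ • κ₁) - V.padicPi p (κ.layerSubgroup 0) β₁ (N₂ • κ₂) := by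
    rw [e₁, e₂, RelaxedEqCompactRank.cramer_fst]
  have hδw : V.padicPi p (κ.layerSubgroup 0) (α₁ * β₂ - α₂ * β₁) (V.endPi hψ p (κ.layerSubgroup 0) z) =
      V.padicPi p (κ.layerSubgroup 0) α₁ (N₂ • κ₂) - V.padicPi p (κ.layerSubgroup 0) α₂ (N₁ • κ₁) := by
    rw [e₁, e₂, RelaxedEqCompactRank.cramer_snd]
  have hSz : V.padicPi p (κ.layerSubgroup 0) (α₁ * β₂ - α₂ * β₁) z ∈ M := by
    rw [hδz]; exact sub_mem (hM β₂ (hMz N₁ h₁)) (hM β₁ (hMz N₂ h₂))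
  have hSw : V.padicPi p (κ.layerSubgroup 0) (α₁ * β₂ - α₂ * β₁) (V.endPi hψ p (κ.layerSubgroup 0) z) ∈ M := by
    rw [hδw]; exact sub_mem (hM α₁ (hMz N₂ h₂)) (hM α₂ (hMz N₁ h₁))
  -- `δ ≠ 0`
  have hNcast : ∀ {N : ℤ}, N ≠ 0 → (N : ℤ_[p]) ≠ 0 := fun hN ↦ Int.cast_ne_zero.2 hN
  have hδ0 : α₁ * β₂ - α₂ * β₁ ≠ 0 := by
    intro hδ0
    have hz0 : V.padicPi p (κ.layerSubgroup 0) (β₂ * (N₁ : ℤ_[p])) κ₁ +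
        V.padicPi p (κ.layerSubgroup 0) (-(β₁ * (N₂ : ℤ_[p]))) κ₂ = 0 := by
      rw [KummerCore.padicPi_neg_left_of_levelTorsion (EndRankTwo.levelTorsion V p _ κ₂), ← sub_eq_add_neg,
        ← padicPi_padicPi, ← padicPi_padicPi, ← EndRankTwo.zsmul_eq_padicPi,
        ← EndRankTwo.zsmul_eq_padicPi, ← hδz, hδ0, KummerCore.padicPi_zero_left]
    have hw0 : V.padicPi p (κ.layerSubgroup 0) (-(α₂ * (N₁ : ℤ_[p]))) κ₁ +
        V.padicPi p (κ.layerSubgroup 0) (α₁ * (N₂ : ℤ_[p])) κ₂ = 0 := by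
      rw [KummerCore.padicPi_neg_left_of_levelTorsion (EndRankTwo.levelTorsion V p _ κ₁), add_comm,
        ← sub_eq_add_neg, ← padicPi_padicPi, ← padicPi_padicPi, ← EndRankTwo.zsmul_eq_padicPi,
        ← EndRankTwo.zsmul_eq_padicPi, ← hδw, hδ0, KummerCore.padicPi_zero_left]
    obtain ⟨-, hb₁⟩ := hind _ _ hz0
    obtain ⟨-, ha₁⟩ := hind _ _ hw0
    have hβ₁ : β₁ = 0 := (mul_eq_zero.1 (neg_eq_zero.1 hb₁)).resolve_right (hNcast hN₂)
    have hα₁ : α₁ = 0 := (mul_eq_zero.1 ha₁).resolve_right (hNcast hN₂)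
    have hN0 : V.padicPi p (κ.layerSubgroup 0) (N₁ : ℤ_[p]) κ₁ + V.padicPi p (κ.layerSubgroup 0) 0 κ₂ = 0 := by
      rw [KummerCore.padicPi_zero_left, add_zero, ← EndRankTwo.zsmul_eq_padicPi, e₁, hα₁, hβ₁,
        KummerCore.padicPi_zero_left, KummerCore.padicPi_zero_left, add_zero]
    exact hNcast hN₁ (hind _ _ hN0).1
  obtain ⟨a, u, hu⟩ : ∃ (a : ℕ) (u : ℤ_[p]ˣ), α₁ * β₂ - α₂ * β₁ = (u : ℤ_[p]) * (p : ℤ_[p]) ^ a :=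
    ⟨(α₁ * β₂ - α₂ * β₁).valuation, PadicInt.unitCoeff hδ0, PadicInt.unitCoeff_spec hδ0⟩
  -- the multiple of `x`
  obtain ⟨N, hN, α, β, e⟩ := RelaxedEqCompactRank.exists_zsmul_eq_pair_of_mem_relaxed V p κ P hψ hall hc hx
  have hδx : V.padicPi p (κ.layerSubgroup 0) (α₁ * β₂ - α₂ * β₁) (N • x) ∈ M := by
    rw [e, map_add, RelaxedEqCompactRank.padicPi_comm V p _ _ α, RelaxedEqCompactRank.padicPi_comm V p _ _ β]
    exact add_mem (hM α hSz) (hM β hSw)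
  refine ⟨((p : ℤ) ^ a) * N, mul_ne_zero (pow_ne_zero a (Int.natCast_ne_zero.2 hp.ne_zero)) hN, ?_⟩
  have h := hM ((u⁻¹ : ℤ_[p]ˣ) : ℤ_[p]) hδx
  rw [padicPi_padicPi, hu, ← mul_assoc, Units.inv_mul, one_mul] at h
  rw [mul_zsmul, EndRankTwo.zsmul_eq_padicPi V p _ ((p : ℤ) ^ a)]
  push_cast
  exact h

end Cramer

/-! ## (sat) at an O11 frame, unconditionally; the typed stub body at every prime; the registered stub -/

section Frame

variable (W : WeierstrassCurve ℚ) [W.IsElliptic] [W.IsGloballyMinimal] (p : ℕ) [Fact p.Prime]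
  {K : Type} [Field K] [NumberField K] {𝔭 : HeightOneSpectrum (𝓞 K)}
  {W' : WeierstrassCurve ℚ} [W'.IsElliptic] [W'.IsGloballyMinimal] {C : VariableChange ℚ}

omit [W.IsGloballyMinimal] in
/-- The Kummer family of an `H`-fixed point is a Mordell–Weil class (`1 · κ(P)`).
[cite: Howard2004HeegnerKolyvagin, §1 (the compact Kummer map)] -/
theorem kummerFamily_mem_mordellWeilKummerSpan (H : Subgroup (absoluteGaloisGroup K))
    (m : (W.baseChange K).fixedGeomPoints H) :
    (W.baseChange K).kummerFamily p H m ∈ (W.baseChange K).mordellWeilKummerSpan p H := by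
  haveI : (W.baseChange K).IsElliptic := inferInstanceAs (W.map (algebraMap ℚ K)).IsElliptic
  have h := (W.baseChange K).padicPi_mem_kummerSpan p H
    (S := ((W.baseChange K).fixedGeomPoints H : Set (geomPoints (W.baseChange K))))
    (fun P hP ↦ ((W.baseChange K).mem_fixedGeomPoints_iff P).1 hP) m.2 1
    ((W.baseChange K).isKummerFamilyOver_kummerFamily p H m)
  rwa [padicPi_one] at h

/-- **(sat) at an O11 frame from the bottom index exponent alone, UNCONDITIONALLY**:
`[S_rel : tors ⊔ 𝒪_𝔭 · z] = p^c`, `P ∈ W(ℚ)`, `P' ∈ W'(ℚ)` of infinite order ⟹ `S_{p,rel}(E/K) ≤ E(K) ⊗ ℤ_p`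
(bottom layer of any `ℤ_p`-tower `κ` of `K`, any relaxed set `Pl`): `S_rel = S_p`
(`RelaxedEqCompactRank.relaxed_eq_compact_of_frame`), every `x ∈ S_rel` has a multiple in `E(K) ⊗ ℤ_p`
((G1) with `M := E(K) ⊗ ℤ_p ∋ κ(P_K), κ(T₂)`), and `E(K) ⊗ ℤ_p` is saturated among compatible families
(`BottomSaturationRank.mem_mordellWeilKummerSpan_of_zsmul_mem`, `moduleFinite_fixedGeomPoints_top`).
[cite: BurungaleKobayashiNakamuraOta2026, §3.1.2, §3.3.1 and Prop. 3.7 (arXiv:2608.06879 pp. 16, 19–20) (shape only)]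
[cite: PerrinRiou1987BSMF, §0 pp. 401–402] [cite: SilvermanAEC2009, Thm. VIII.6.7, Cor. III.9.4, Exercise 10.16] -/
theorem relaxed_le_mordellWeilKummerSpan_of_frame_rank (hF : X12.O11.IsFrame W p K 𝔭 W' C)
    {P : W.toAffine.Point} (hP : ¬ IsOfFinAddOrder P) {P' : W'.toAffine.Point}
    (hP' : ¬ IsOfFinAddOrder P') (κ : ZpExtension K p) (Pl : Set (HeightOneSpectrum (𝓞 K)))
    {z : (W.baseChange K).torsionH1Pi p (κ.layerSubgroup 0)} {c : ℕ}
    (hc : (AddCommGroup.torsion ((W.baseChange K).torsionH1Pi p (κ.layerSubgroup 0)) ⊔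
        (W.baseChange K).padicEndSpan p (κ.layerSubgroup 0) z).relIndex
      ((W.baseChange K).relaxedCompactSelmerOver (κ.layerSubgroup 0) p Pl) = p ^ c) :
    (W.baseChange K).relaxedCompactSelmerOver (κ.layerSubgroup 0) p Pl ≤
      (W.baseChange K).mordellWeilKummerSpan p (κ.layerSubgroup 0) := by
  haveI : (W.baseChange K).IsElliptic := inferInstanceAs (W.map (algebraMap ℚ K)).IsElliptic
  obtain ⟨m₁, m₂, hind⟩ := RelaxedEqCompactRank.exists_independent_kummerFamilies_of_frame W p hF hP hP'
    (κ.layerSubgroup 0) (ZpExtension.layerSubgroup_zero κ)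
  have heq := RelaxedEqCompactRank.relaxed_eq_compact_of_frame W p hF hP hP' κ Pl hc
  have hMW₁ := kummerFamily_mem_mordellWeilKummerSpan W p (κ.layerSubgroup 0) m₁
  have hMW₂ := kummerFamily_mem_mordellWeilKummerSpan W p (κ.layerSubgroup 0) m₂
  have hrel : (W.baseChange K).mordellWeilKummerSpan p (κ.layerSubgroup 0) ≤
      (W.baseChange K).relaxedCompactSelmerOver (κ.layerSubgroup 0) p Pl :=
    (KummerFamiliesSelmer.mordellWeilKummerSpan_le_compactSelmerOver (W.baseChange K) p κ).trans
      ((W.baseChange K).compactSelmerOver_le_relaxedCompactSelmerOver _ p Pl)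
  have hfg := BottomSaturationRank.moduleFinite_fixedGeomPoints_top (W.baseChange K) (κ.layerSubgroup 0)
    (ZpExtension.layerSubgroup_zero κ)
  intro x hx
  obtain ⟨N, hN, hNx⟩ := exists_zsmul_mem_of_rank (W.baseChange K) p κ Pl
    ((W.baseChange K).mordellWeilKummerSpan p (κ.layerSubgroup 0))
    (fun c {y} hy ↦ BottomLocalIndexSplit.padicPi_mem_mordellWeilKummerSpan (W.baseChange K) p _ c hy)
    hc hMW₁ hMW₂ (hrel hMW₁) (hrel hMW₂) hind hx
  have hxS : x ∈ (W.baseChange K).compactSelmerOver (κ.layerSubgroup 0) p := by rw [← heq]; exact hx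
  exact BottomSaturationRank.mem_mordellWeilKummerSpan_of_zsmul_mem (W.baseChange K) p (κ.layerSubgroup 0)
    hfg ((W.baseChange K).mem_compatiblePi_iff.2 (((W.baseChange K).mem_compactSelmerOver_iff _ p x).1 hxS).2)
    hN hNx

/-- **THE TYPED STUB BODY AT EVERY PRIME, UNCONDITIONALLY: `X12.O11.RamifiedCMBottomSaturationAtZp W p`
holds for every globally minimal `W/ℚ` and every prime `p`** — of its binders only the frame, the infinite
order of `P`, `P'` and `hcZp` are used (GZK, `hm`, (inj), the pin and the IMC identity are idle).
[cite: PerrinRiou1987BSMF, §0 pp. 401–402] [cite: SilvermanAEC2009, Cor. III.9.4 and Thm. VIII.6.7] -/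
theorem ramifiedCMBottomSaturationAtZp_holds : X12.O11.RamifiedCMBottomSaturationAtZp W p := by
  intro K _ _ 𝔭 W' _ _ C hF _ κ _ γ _ P n P' n' hP _ _ _ _ hP' _ _ _ _ q q' _ _ ι φ Ω 𝓔 D c _ _ hc _ m _ _
  exact relaxed_le_mordellWeilKummerSpan_of_frame_rank W p hF hP hP' κ {𝔭} hc

end Frame

end BottomSaturationUncond

/-- **Stub S_sat-Zp of the line `rubin-formula-zp` on crux `EllipticUnitValueSevenOfGZK`
(stmt-BirchSwinnertonDyer-19945) — PROVED, registered name and signature verbatim**: `GZK → ∀ W ∈ 𝒞₇,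
X12.O11.RamifiedCMBottomSaturationAtZp W 7` (the GZK antecedent and the class hypothesis are not used:
`BottomSaturationUncond.ramifiedCMBottomSaturationAtZp_holds` at `p = 7`). Closes the stub only; the crux
stays open on S_open; BSD is not claimed. [cite: PerrinRiou1987BSMF, §0 pp. 401–402]
[cite: SilvermanAEC2009, Cor. III.9.4 and Thm. VIII.6.7] -/
theorem stub_bottomSaturationSevenZpOfGZK :
    Literature.NumberTheory.EllipticCurves.rank_eq_analyticRank_of_analyticRank_le_one →
    ∀ (W : WeierstrassCurve ℚ) [W.IsElliptic] [W.IsGloballyMinimal] [Fact (Nat.Prime 7)],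
      X12.ClassCSeven W → X12.O11.RamifiedCMBottomSaturationAtZp W 7 :=
  fun _ W _ _ _ _ ↦ BottomSaturationUncond.ramifiedCMBottomSaturationAtZp_holds W 7

end Summit.BirchSwinnertonDyer.BirchSwinnertonDyer.Theorems.RamifiedSevenEllipticUnits

end
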